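import Mathlib
import Summits.Ventures.LatticeQCDFlow.Scaling.GroupLayerHaar
import Summits.Ventures.LatticeQCDFlow.Scaling.U1LayerWords

/-!
# LatticeQCDFlow / Scaling — the slab cost for a general compact gauge group: bond substitution,
# the order-four kernel and its CENTRING without any word combinatorics

HONEST FRAMING: exact (Metropolis-corrected) sampling algorithms for lattice gauge theory;
figures of merit are autocorrelation/cost numbers at stated couplings and volumes; no
continuum-physics claim.

Venture `LatticeQCDFlow` (cell pub-lqcd), topic `Scaling`, FANOUT row 30 (lean-1) — OUR WORK, file
2 of the extension of the slab-chain proof of (LC)/(U′) to a general compact gauge group `G` with a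
matrix representation `ρ` (the `U(1)` files are `Scaling/U1SlabMoments.lean` etc.).  Layer sites
`LSite`, layer edges `LEdge` (`Scaling/U1LayerWords.lean`); horizontal bond variables `e, e' :
LEdge → G` of two consecutive layers, vertical bond variables `v : LSite → G` of the slab between
them, all Haar.
* `plaqG e v e' ℓ = v(src ℓ) e(ℓ) v(tgt ℓ)⁻¹ e'(ℓ)⁻¹` — the holonomy of the lateral plaquette through
  `ℓ`; `slabCostG ρ e v e' = Σ_ℓ Re tr ρ(plaqG e v e' ℓ)`; bounds, continuity, and the expansion
  of its powers in WORDS `w : Fin m → LEdge` (`slabCostG_pow_eq_sum`);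
* **BOND SUBSTITUTION** (`integral_comp_plaqG_left/right`): for fixed `(v, e')` the map
  `e ↦ (ℓ ↦ plaqG e v e' ℓ)` is a two-sided translate of `e` in the product group, and for fixed
  `(e, v)` the map `e' ↦ (ℓ ↦ plaqG e v e' ℓ)` is an inversion followed by a translate; both preserve
  the Haar product, so `∫ H(plaqG e v e' ·) de = ∫ H de = ∫ H(plaqG e v e' ·) de'` — after
  integrating ONE layer the lateral plaquettes are free (the two-dimensional mechanism);
* the order-four kernel `K4G ρ e e' = ∫ slabCostG⁴ dv`, its mean `c4G ρ = ∫ (Σ_ℓ Re tr ρ(u ℓ))⁴ du`,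
  the centred kernel `rho4G = (K4G − c4G)/4!`; **`integral_K4G_left/right`** (`∫ K4G(e,e') de =
  c4G = ∫ K4G(e,e') de'`, by bond substitution and Fubini) hence **`integral_rho4G_left/right = 0`**
  — the vanishing marginals required by the slab-chain theorem, for ANY compact `G` and ANY `ρ`;
  joint continuity / measurability / bounds of `K4G`, `rho4G`; `integral_slabCostG_pow_four`.
The low moments (girth) and the eigenvalue are the sequel files.  Elementary; nothing is cited as
a fact [cite: MontvayMunster1994, §3.6.2]; `def`s `plaqG`, `slabCostG`, `K4G`, `c4G`, `rho4G`;
no `sorry`.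
-/

noncomputable section

open MeasureTheory Filter Finset
open Literature.MathematicalPhysics.QuantumFieldTheory
open Summit.Ventures.LatticeQCDFlow.Theory2.Lattice.U1Layer (LSite LEdge)

namespace Summit.Ventures.LatticeQCDFlow.Theory2.GroupLayer

variable {G : Type*} [Group G] [TopologicalSpace G] [IsTopologicalGroup G] [CompactSpace G]
  [MeasurableSpace G] [BorelSpace G]
variable {d L : ℕ} {a : Fin d} {N : ℕ} (ρ : G →* Matrix (Fin N) (Fin N) ℂ)

/-! ## 1. The slab cost -/

omit [TopologicalSpace G] [IsTopologicalGroup G] [CompactSpace G] [MeasurableSpace G] [BorelSpace G] in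
/-- The holonomy of the lateral plaquette through the layer edge `ℓ`:
`v(src ℓ) · e(ℓ) · v(tgt ℓ)⁻¹ · e'(ℓ)⁻¹`. [folklore] -/
def plaqG (e : LEdge d L a → G) (v : LSite d L a → G) (e' : LEdge d L a → G) (ℓ : LEdge d L a) : G :=
  v ℓ.src * e ℓ * (v ℓ.tgt)⁻¹ * (e' ℓ)⁻¹

variable [NeZero L]

omit [TopologicalSpace G] [IsTopologicalGroup G] [CompactSpace G] [MeasurableSpace G] [BorelSpace G] in
/-- **The slab cost** of the representation `ρ`: the sum of `Re tr ρ` of the lateral plaquettes of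
a slab. [folklore] -/
def slabCostG (e : LEdge d L a → G) (v : LSite d L a → G) (e' : LEdge d L a → G) : ℝ :=
  ∑ ℓ, trRe ρ (plaqG e v e' ℓ)

omit [IsTopologicalGroup G] [MeasurableSpace G] [BorelSpace G] in
/-- `|slabCostG| ≤ #LEdge · trReBound`. [folklore] -/
theorem abs_slabCostG_le (hρ : Continuous ρ) (e : LEdge d L a → G) (v : LSite d L a → G)
    (e' : LEdge d L a → G) :
    |slabCostG ρ e v e'| ≤ Fintype.card (LEdge d L a) * trReBound (G := G) (ρ := ρ) hρ := by
  unfold slabCostG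
  refine (Finset.abs_sum_le_sum_abs _ _).trans ?_
  calc ∑ ℓ, |trRe ρ (plaqG e v e' ℓ)| ≤ ∑ _ℓ : LEdge d L a, trReBound (G := G) (ρ := ρ) hρ :=
        sum_le_sum fun ℓ _ => abs_trRe_le hρ _
    _ = Fintype.card (LEdge d L a) * trReBound (G := G) (ρ := ρ) hρ := by simp

omit [CompactSpace G] [MeasurableSpace G] [BorelSpace G] [NeZero L] in
/-- The lateral plaquette holonomy is jointly continuous in `(e, v, e')`. [folklore] -/
theorem continuous_plaqG (ℓ : LEdge d L a) :
    Continuous fun p : (LEdge d L a → G) × (LSite d L a → G) × (LEdge d L a → G) =>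
      plaqG p.1 p.2.1 p.2.2 ℓ := by
  unfold plaqG
  fun_prop

omit [CompactSpace G] [MeasurableSpace G] [BorelSpace G] in
/-- The slab cost is jointly continuous. [folklore] -/
theorem continuous_slabCostG (hρ : Continuous ρ) :
    Continuous fun p : (LEdge d L a → G) × (LSite d L a → G) × (LEdge d L a → G) =>
      slabCostG ρ p.1 p.2.1 p.2.2 := by
  unfold slabCostG
  exact continuous_finsetSum _ fun ℓ _ => (continuous_trRe ρ hρ).comp (continuous_plaqG ℓ)

omit [TopologicalSpace G] [IsTopologicalGroup G] [CompactSpace G] [MeasurableSpace G] [BorelSpace G] in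
/-- **Expansion of a power of the slab cost in words**:
`(slabCostG)^m = Σ_{w : Fin m → LEdge} ∏_k Re tr ρ(plaqG (w k))`. [folklore] -/
theorem slabCostG_pow_eq_sum (e : LEdge d L a → G) (v : LSite d L a → G) (e' : LEdge d L a → G)
    (m : ℕ) :
    ((slabCostG ρ e v e' : ℝ) : ℂ) ^ m =
      ∑ w : Fin m → LEdge d L a, ∏ k, (trRe ρ (plaqG e v e' (w k)) : ℂ) := by
  unfold slabCostG
  push_cast
  rw [Fintype.sum_pow]

/-! ## 2. Bond substitution: after integrating one layer the lateral plaquettes are free -/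

omit [TopologicalSpace G] [IsTopologicalGroup G] [CompactSpace G] [MeasurableSpace G] [BorelSpace G]
  [NeZero L] in
/-- The lateral plaquettes as a two-sided translate of the lower layer. [folklore] -/
theorem plaqG_eq_mul_left (e : LEdge d L a → G) (v : LSite d L a → G) (e' : LEdge d L a → G) :
    (fun ℓ => plaqG e v e' ℓ) =
      (fun ℓ : LEdge d L a => v ℓ.src) * e * fun ℓ => (v ℓ.tgt)⁻¹ * (e' ℓ)⁻¹ := by
  funext ℓ
  simp only [plaqG, Pi.mul_apply, mul_assoc]

omit [TopologicalSpace G] [IsTopologicalGroup G] [CompactSpace G] [MeasurableSpace G] [BorelSpace G]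
  [NeZero L] in
/-- The lateral plaquettes as a translate of the inverted upper layer. [folklore] -/
theorem plaqG_eq_mul_right (e : LEdge d L a → G) (v : LSite d L a → G) (e' : LEdge d L a → G) :
    (fun ℓ => plaqG e v e' ℓ) = (fun ℓ : LEdge d L a => v ℓ.src * e ℓ * (v ℓ.tgt)⁻¹) * e'⁻¹ := by
  funext ℓ
  simp only [plaqG, Pi.mul_apply, Pi.inv_apply]

/-- **Bond substitution in the lower layer**: `∫ H(plaqG e v e' ·) de = ∫ H(e) de`. [folklore] -/
theorem integral_comp_plaqG_left (H : (LEdge d L a → G) → ℂ) (v : LSite d L a → G)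
    (e' : LEdge d L a → G) :
    ∫ e, H (fun ℓ => plaqG e v e' ℓ) ∂(Measure.pi fun _ : LEdge d L a => haarProbability G) =
      ∫ e, H e ∂(Measure.pi fun _ : LEdge d L a => haarProbability G) := by
  simp_rw [plaqG_eq_mul_left]
  have h1 := integral_mul_right_eq_self (μ := Measure.pi fun _ : LEdge d L a => haarProbability G)
    (fun x : LEdge d L a → G => H ((fun ℓ : LEdge d L a => v ℓ.src) * x))
    (fun ℓ => (v ℓ.tgt)⁻¹ * (e' ℓ)⁻¹)
  simp only [← mul_assoc] at h1
  rw [h1]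
  exact integral_mul_left_eq_self H _

/-- **Bond substitution in the upper layer**: `∫ H(plaqG e v e' ·) de' = ∫ H(e') de'`. [folklore] -/
theorem integral_comp_plaqG_right (H : (LEdge d L a → G) → ℂ) (e : LEdge d L a → G)
    (v : LSite d L a → G) :
    ∫ e', H (fun ℓ => plaqG e v e' ℓ) ∂(Measure.pi fun _ : LEdge d L a => haarProbability G) =
      ∫ e', H e' ∂(Measure.pi fun _ : LEdge d L a => haarProbability G) := by
  simp_rw [plaqG_eq_mul_right]
  have h1 := integral_inv_eq_self
    (fun x : LEdge d L a → G => H ((fun ℓ : LEdge d L a => v ℓ.src * e ℓ * (v ℓ.tgt)⁻¹) * x))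
    (Measure.pi fun _ : LEdge d L a => haarProbability G)
  rw [h1]
  exact integral_mul_left_eq_self H _

omit [TopologicalSpace G] [IsTopologicalGroup G] [CompactSpace G] [MeasurableSpace G] [BorelSpace G] in
/-- The free fourth moment integrand `u ↦ (Σ_ℓ Re tr ρ(u ℓ))⁴` as the slab cost at `v = 1`,
`e' = 1`. [folklore] -/
theorem slabCostG_one_one (u : LEdge d L a → G) :
    slabCostG ρ u 1 1 = ∑ ℓ, trRe ρ (u ℓ) := by
  simp [slabCostG, plaqG]

/-! ## 3. The order-four kernel and its centring -/

/-- The vertical moment of order four, `K4G e e' = ∫ slabCostG(e,v,e')⁴ dv`. [folklore] -/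
def K4G (e e' : LEdge d L a → G) : ℂ :=
  ∫ v, ((slabCostG ρ e v e' : ℝ) : ℂ) ^ 4 ∂(Measure.pi fun _ : LSite d L a => haarProbability G)

/-- The mean of the order-four moment: the free fourth moment `c4G = ∫ (Σ_ℓ Re tr ρ(u ℓ))⁴ du`.
[folklore] -/
def c4G (ρ : G →* Matrix (Fin N) (Fin N) ℂ) (d L : ℕ) [NeZero L] (a : Fin d) : ℂ :=
  ∫ u, (((∑ ℓ, trRe ρ (u ℓ) : ℝ)) : ℂ) ^ 4 ∂(Measure.pi fun _ : LEdge d L a => haarProbability G)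

/-- **The centred order-four kernel** `ρ₄(e, e') = (K4G(e,e') − c4G)/4!`. [folklore] -/
def rho4G (e e' : LEdge d L a → G) : ℂ := (K4G ρ e e' - c4G ρ d L a) / 24

section Kernel

variable [SecondCountableTopology G] {ρ} (hρ : Continuous ρ)
include hρ

omit [IsTopologicalGroup G] [MeasurableSpace G] [BorelSpace G] [SecondCountableTopology G] in
/-- Pointwise bound of the fourth power of the slab cost. [folklore] -/
theorem norm_slabCostG_pow_four_le (e : LEdge d L a → G) (v : LSite d L a → G) (e' : LEdge d L a → G) :
    ‖((slabCostG ρ e v e' : ℝ) : ℂ) ^ 4‖ ≤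
      (Fintype.card (LEdge d L a) * trReBound (G := G) (ρ := ρ) hρ) ^ 4 := by
  rw [norm_pow, Complex.norm_real, Real.norm_eq_abs]
  exact pow_le_pow_left₀ (abs_nonneg _) (abs_slabCostG_le ρ hρ e v e') 4

omit [SecondCountableTopology G] in
/-- `K4G` is bounded: `‖K4G‖ ≤ (#LEdge · trReBound)^4`. [folklore] -/
theorem norm_K4G_le (e e' : LEdge d L a → G) :
    ‖K4G ρ e e'‖ ≤ (Fintype.card (LEdge d L a) * trReBound (G := G) (ρ := ρ) hρ) ^ 4 := by
  unfold K4G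
  have h := norm_integral_le_of_norm_le_const
    (μ := Measure.pi fun _ : LSite d L a => haarProbability G)
    (Eventually.of_forall fun v => norm_slabCostG_pow_four_le hρ e v e')
  simpa using h

/-- **`K4G` is jointly continuous** (a parametric integral of a bounded continuous function over a
compact probability space). [folklore] -/
theorem continuous_K4G : Continuous fun p : (LEdge d L a → G) × (LEdge d L a → G) =>
    K4G ρ p.1 p.2 := by
  unfold K4G
  have hc : Continuous (Function.uncurry fun (p : (LEdge d L a → G) × (LEdge d L a → G))
      (v : LSite d L a → G) => ((slabCostG ρ p.1 v p.2 : ℝ) : ℂ) ^ 4) :=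
    (Complex.continuous_ofReal.comp ((continuous_slabCostG ρ hρ).comp
      ((continuous_fst.comp continuous_fst).prodMk (continuous_snd.prodMk
        (continuous_snd.comp continuous_fst))))).pow 4
  have h := continuous_parametric_integral_of_continuous
    (μ := Measure.pi fun _ : LSite d L a => haarProbability G) hc isCompact_univ
  simpa [Measure.restrict_univ] using h

/-- `K4G` is jointly measurable. [folklore] -/
theorem measurable_K4G : Measurable fun p : (LEdge d L a → G) × (LEdge d L a → G) =>
    K4G ρ p.1 p.2 :=
  (continuous_K4G hρ).measurable

/-- `rho4G` is jointly measurable. [folklore] -/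
theorem measurable_rho4G : Measurable (Function.uncurry (rho4G (d := d) (L := L) (a := a) ρ)) := by
  have h : Function.uncurry (rho4G (d := d) (L := L) (a := a) ρ) =
      fun p => (K4G ρ p.1 p.2 - c4G ρ d L a) / 24 := by
    funext p; rfl
  rw [h]
  exact ((measurable_K4G hρ).sub measurable_const).div_const _

omit [SecondCountableTopology G] in
/-- `rho4G` is bounded. [folklore] -/
theorem norm_rho4G_le (e e' : LEdge d L a → G) :
    ‖rho4G ρ e e'‖ ≤ ((Fintype.card (LEdge d L a) * trReBound (G := G) (ρ := ρ) hρ) ^ 4 +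
      ‖c4G ρ d L a‖) / 24 := by
  unfold rho4G
  rw [norm_div, show ‖(24 : ℂ)‖ = 24 by norm_num]
  exact div_le_div_of_nonneg_right ((norm_sub_le _ _).trans (add_le_add (norm_K4G_le hρ e e')
    le_rfl)) (by norm_num)

/-- The fourth power of the slab cost is integrable on `(lower layer) × (vertical bonds)`. [folklore] -/
theorem integrable_slabCostG_pow_four_left (e' : LEdge d L a → G) :
    Integrable (Function.uncurry fun (e : LEdge d L a → G) (v : LSite d L a → G) =>
        ((slabCostG ρ e v e' : ℝ) : ℂ) ^ 4)
      ((Measure.pi fun _ : LEdge d L a => haarProbability G).prod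
        (Measure.pi fun _ : LSite d L a => haarProbability G)) := by
  have hc : Continuous (Function.uncurry fun (e : LEdge d L a → G) (v : LSite d L a → G) =>
      ((slabCostG ρ e v e' : ℝ) : ℂ) ^ 4) :=
    (Complex.continuous_ofReal.comp ((continuous_slabCostG ρ hρ).comp
      (continuous_fst.prodMk (continuous_snd.prodMk continuous_const)))).pow 4
  exact Integrable.of_bound hc.measurable.aestronglyMeasurable _
    (Eventually.of_forall fun p => norm_slabCostG_pow_four_le hρ p.1 p.2 e')

/-- The fourth power of the slab cost is integrable on `(upper layer) × (vertical bonds)`. [folklore] -/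
theorem integrable_slabCostG_pow_four_right (e : LEdge d L a → G) :
    Integrable (Function.uncurry fun (e' : LEdge d L a → G) (v : LSite d L a → G) =>
        ((slabCostG ρ e v e' : ℝ) : ℂ) ^ 4)
      ((Measure.pi fun _ : LEdge d L a => haarProbability G).prod
        (Measure.pi fun _ : LSite d L a => haarProbability G)) := by
  have hc : Continuous (Function.uncurry fun (e' : LEdge d L a → G) (v : LSite d L a → G) =>
      ((slabCostG ρ e v e' : ℝ) : ℂ) ^ 4) :=
    (Complex.continuous_ofReal.comp ((continuous_slabCostG ρ hρ).comp
      (continuous_const.prodMk (continuous_snd.prodMk continuous_fst)))).pow 4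
  exact Integrable.of_bound hc.measurable.aestronglyMeasurable _
    (Eventually.of_forall fun p => norm_slabCostG_pow_four_le hρ e p.2 p.1)

/-- **First marginal of `K4G`**: `∫ K4G(e, e') de = c4G` (Fubini and bond substitution in the lower
layer). [folklore] -/
theorem integral_K4G_left (e' : LEdge d L a → G) :
    ∫ e, K4G ρ e e' ∂(Measure.pi fun _ : LEdge d L a => haarProbability G) = c4G ρ d L a := by
  unfold K4G
  rw [integral_integral_swap (integrable_slabCostG_pow_four_left hρ e')]
  have hin : ∀ v : LSite d L a → G,
      ∫ e, ((slabCostG ρ e v e' : ℝ) : ℂ) ^ 4 ∂(Measure.pi fun _ : LEdge d L a => haarProbability G) =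
        c4G ρ d L a := by
    intro v
    have h := integral_comp_plaqG_left (fun u : LEdge d L a → G =>
      (((∑ ℓ, trRe ρ (u ℓ) : ℝ)) : ℂ) ^ 4) v e'
    simpa only [slabCostG, c4G] using h
  simp_rw [hin]
  rw [integral_const, probReal_univ, one_smul]

/-- **Second marginal of `K4G`**: `∫ K4G(e, e') de' = c4G` (Fubini and bond substitution in the upper
layer). [folklore] -/
theorem integral_K4G_right (e : LEdge d L a → G) :
    ∫ e', K4G ρ e e' ∂(Measure.pi fun _ : LEdge d L a => haarProbability G) = c4G ρ d L a := by
  unfold K4G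
  rw [integral_integral_swap (integrable_slabCostG_pow_four_right hρ e)]
  have hin : ∀ v : LSite d L a → G,
      ∫ e', ((slabCostG ρ e v e' : ℝ) : ℂ) ^ 4 ∂(Measure.pi fun _ : LEdge d L a => haarProbability G) =
        c4G ρ d L a := by
    intro v
    have h := integral_comp_plaqG_right (fun u : LEdge d L a → G =>
      (((∑ ℓ, trRe ρ (u ℓ) : ℝ)) : ℂ) ^ 4) e v
    simpa only [slabCostG, c4G] using h
  simp_rw [hin]
  rw [integral_const, probReal_univ, one_smul]

/-- `K4G(·, e')` is integrable. [folklore] -/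
theorem integrable_K4G_left (e' : LEdge d L a → G) :
    Integrable (fun e => K4G ρ e e') (Measure.pi fun _ : LEdge d L a => haarProbability G) :=
  Integrable.of_bound ((measurable_K4G hρ).comp
    (measurable_id.prodMk measurable_const)).aestronglyMeasurable _
    (Eventually.of_forall fun e => norm_K4G_le hρ e e')

/-- `K4G(e, ·)` is integrable. [folklore] -/
theorem integrable_K4G_right (e : LEdge d L a → G) :
    Integrable (fun e' => K4G ρ e e') (Measure.pi fun _ : LEdge d L a => haarProbability G) :=
  Integrable.of_bound ((measurable_K4G hρ).comp
    (measurable_const.prodMk measurable_id)).aestronglyMeasurable _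
    (Eventually.of_forall fun e' => norm_K4G_le hρ e e')

omit [SecondCountableTopology G] hρ in
/-- The centred kernel integrates to zero as soon as `K4G` integrates to `c4G`. [folklore] -/
theorem integral_rho4G_eq_zero_of {f : (LEdge d L a → G) → ℂ}
    (hfi : Integrable f (Measure.pi fun _ : LEdge d L a => haarProbability G))
    (hf : ∫ r, f r ∂(Measure.pi fun _ : LEdge d L a => haarProbability G) = c4G ρ d L a) :
    ∫ r, (f r - c4G ρ d L a) / 24 ∂(Measure.pi fun _ : LEdge d L a => haarProbability G) = 0 := by
  simp_rw [div_eq_mul_inv]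
  rw [integral_mul_const, integral_sub hfi (integrable_const _), hf, integral_const, probReal_univ,
    one_smul, sub_self, zero_mul]

/-- **Vanishing first marginal**: `∫ ρ₄(e, e') de = 0`, for every compact `G` and every `ρ`. [folklore] -/
theorem integral_rho4G_left (e' : LEdge d L a → G) :
    ∫ e, rho4G ρ e e' ∂(Measure.pi fun _ : LEdge d L a => haarProbability G) = 0 :=
  integral_rho4G_eq_zero_of (integrable_K4G_left hρ e') (integral_K4G_left hρ e')

/-- **Vanishing second marginal**: `∫ ρ₄(e, e') de' = 0`. [folklore] -/
theorem integral_rho4G_right (e : LEdge d L a → G) :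
    ∫ e', rho4G ρ e e' ∂(Measure.pi fun _ : LEdge d L a => haarProbability G) = 0 :=
  integral_rho4G_eq_zero_of (integrable_K4G_right hρ e) (integral_K4G_right hρ e)

omit [SecondCountableTopology G] hρ in
/-- **The order-four moment identity**: `∫ slabCostG⁴ dv = c4G + 4!·ρ₄(e,e')`. [folklore] -/
theorem integral_slabCostG_pow_four (e e' : LEdge d L a → G) :
    ∫ v, ((slabCostG ρ e v e' : ℝ) : ℂ) ^ 4 ∂(Measure.pi fun _ : LSite d L a => haarProbability G) =
      c4G ρ d L a + ((4 : ℕ).factorial : ℂ) * rho4G ρ e e' := by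
  rw [show ((4 : ℕ).factorial : ℂ) = 24 by norm_num [Nat.factorial], rho4G, ← K4G]
  ring

end Kernel

end Summit.Ventures.LatticeQCDFlow.Theory2.GroupLayer

end
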